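import Summits.BirchSwinnertonDyer.BirchSwinnertonDyer.Theorems.KolyvaginDepthDoorDefs
import Summits.BirchSwinnertonDyer.BirchSwinnertonDyer.Theorems.KolyvaginDepthDoorKolyvaginDepthSupplyDoorSecondSign
import Summits.BirchSwinnertonDyer.BirchSwinnertonDyer.Theses.KolyvaginDepthDoor
import Summits.BirchSwinnertonDyer.BirchSwinnertonDyer.Theses.KatoTransfer
import HarnessLib

/-!
# Route `KolyvaginDepthDoor`, crux `KolyvaginDepthSupply` (stmt-BirchSwinnertonDyer-21765) —
# THE SIGNED DATUM FORM REACHES X1 ON BOTH SIGNS: `KolyvaginDepthSupplySignedDatum` + (γ) + F1 ⟹ X1 on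
# non-CM curves ⟹ (with X1_CM, X2, X3, Kato) BSD-rank — the planner-facing re-typing, repaired

Helper file (`--supports stmt-BirchSwinnertonDyer-21765 --as helper`); it closes nothing and BSD is
not proved by it.

STATE (this seat, g9). The g6–g8 planner-facing forms `KolyvaginDepthSupplyDatum` /
`KolyvaginDepthSupplySystem` are FALSE as stated (`not_kolyvaginDepthSupplyDatum`, file
`…KolyvaginDepthSupplyDatumFalse`: they force positive rank on every non-CM curve). The repaired form
`KolyvaginDepthSupplySignedDatum` (file `…KolyvaginDepthDoorDefs`) restores the crux's second rank clause
`ν ≤ rank E(ℚ) ∧ ν + 1 ≤ rank E^{(d_K)}(ℚ)` next to the first `ν + 1 ≤ rank E(ℚ)`; the door on that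
clause is `shaCorank_eq_zero_of_kolyvaginClass_ne_zero_of_twist_rank_of_datum_gross1991E0` (file
`…DoorSecondSign`: the non-zero class sits on the `−`-eigenspace; `t_p(E) = 0` AND `t_p(E^{(d_K)}) = 0`).
This file re-issues g7/g8's planner-facing chain on the repaired form:

* (The refuted datum form trivially implies the signed one — first member of the disjunction —; that
  implication is vacuous and deliberately NOT recorded as a theorem.)
* `shaCorank_eq_zero_nonCM_of_kolyvaginDepthSupplySignedDatum_print` — signed datum + (γ) + F1 ⟹ for
  every non-CM globally minimal `E/ℚ` a prime `p ≥ 5` of good ordinary reduction with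
  `corank_{ℤ_p} Ш(E/ℚ)[p^∞] = 0`, together with the crux's rank clause AT THE WITNESS in its exact
  (Kolyvagin) form: `(ν + 1 = rank E(ℚ) ∧ rank E^{(d_K)}(ℚ) < rank E(ℚ)) ∨ (ν = rank E(ℚ) ∧
  rank E^{(d_K)}(ℚ) = rank E(ℚ) + 1)`, and `Ш(E/ℚ)[p] = 0`, `#Sel_p(E/ℚ) = p^{rank}`.
* `shaCorankZeroAtOnePrime_of_kolyvaginDepthSupplySignedDatum_print` — with the CM residual
  `ShaCorankZeroAtOnePrimeOfCM`: X1 for EVERY `E/ℚ`, i.e. LITERALLY `KatoTransfer`'s crux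
  `ShaCorankZeroAtOnePrime` (stmt-BirchSwinnertonDyer-18411).
* `bsd_of_kolyvaginDepthSupplySignedDatum_print` — signed datum + (γ) + F1 + X1_CM + X2 + X3 + Kato ⟹
  `BirchSwinnertonDyer`, by HANDING X1 TO `KatoTransfer`'s certified deciding theorem `closes` (this
  route's items X2, X3, Kato ARE KatoTransfer's, verbatim): no transport block is copied, and neither
  `KolyvaginStructure` (XL) nor any McCallum leaf is among the hypotheses.

Every hypothesis is OPEN (`KolyvaginDepthSupplySignedDatum` — of the strength of X1 on non-CM curves —,
X1_CM, X2, X3, Kato) or a named published fact ((γ) = Gross 1991 Prop. 3.7 (2), F1 = [GZ86 III (3.1)]);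
NOTHING class-wide is discharged and BSD is NOT proved by this.

References: [Kolyvagin1991MathAnn] Thm. 2.3, Thm. 4; [GrossLMS1991] Prop. 3.7 (2), §5 (5.1), §10;
[GrossZagier1986] III (3.1); [McCallumLMS1991] §§2–5; [Kato2004Asterisque] Thm. 17.4.
-/

set_option linter.dupNamespace false

noncomputable section

open scoped Classical

namespace Summit.BirchSwinnertonDyer.BirchSwinnertonDyer.Theorems.KolyvaginDepthDoor

open Literature Literature.NumberTheory.EllipticCurves Literature.NumberTheory.EllipticCurves.ModularForms
  WeierstrassCurve NumberField IsDedekindDomain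
open Summit.BirchSwinnertonDyer.BirchSwinnertonDyer.Theses.KolyvaginDepthDoor

/-- **Signed datum + (γ) + F1 ⟹ X1 on non-CM curves, with the crux's rank clause at the witness.**
Granted `KolyvaginDepthSupplySignedDatum`, (γ) = `GrossLMS1991.prop37_2_frobeniusCongruence` and F1 =
`Gross1991_heegnerPoint_sub_ratTorsion_mem_E0`: every non-CM globally minimal elliptic `E/ℚ` has a prime
`p ≥ 5` of good ordinary reduction with `corank_{ℤ_p} Ш(E/ℚ)[p^∞] = 0`; at the witness `(K, n₁)` the
crux's rank clause holds in Kolyvagin's exact form `(ν + 1 = rank E(ℚ) ∧ rank E^{(d_K)}(ℚ) < rank E(ℚ))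
∨ (ν = rank E(ℚ) ∧ rank E^{(d_K)}(ℚ) = rank E(ℚ) + 1)`, and `Ш(E/ℚ)[p] = 0`, `#Sel_p(E/ℚ) = p^{rank}`.
Proof: case split on the signed clause; first member → the door of a datum
`shaCorank_eq_zero_of_kolyvaginClass_ne_zero_of_rank_le_of_datum_gross1991E0` (g8), second member →
the door on the other sign `…_of_twist_rank_of_datum_gross1991E0` (g9). NO Kolyvagin Thm. 4, NO system,
NO McCallum leaf. CONDITIONAL on `hS`, (γ), F1; BSD is not proved by it.
[cite: Kolyvagin1991MathAnn, Thm. 2.3] [cite: GrossLMS1991, Prop. 3.7 (2), §5 (5.1), §10]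
[cite: GrossZagier1986, III (3.1)] -/
theorem shaCorank_eq_zero_nonCM_of_kolyvaginDepthSupplySignedDatum_print
    (hS : KolyvaginDepthSupplySignedDatum) (h372 : GrossLMS1991.prop37_2_frobeniusCongruence)
    (hE0 : Gross1991_heegnerPoint_sub_ratTorsion_mem_E0)
    (W : WeierstrassCurve ℚ) [W.IsElliptic] [W.IsGloballyMinimal] (hcm : ¬ W.HasCM) :
    ∃ (p : ℕ) (_ : Fact p.Prime), 5 ≤ p ∧ W.HasGoodReductionAtPrime p ∧
      ¬ (p : ℤ) ∣ W.frobeniusTrace p ∧ W.shaCorank p = 0 ∧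
      ∃ (K : Type) (_ : Field K) (_ : NumberField K) (n₁ : ℕ), IsImaginaryQuadratic K ∧
        ((n₁.primeFactors.card + 1 = W.mordellWeilRank ∧
            (W.quadraticTwist (NumberField.discr K : ℚ)).mordellWeilRank < W.mordellWeilRank) ∨
          (n₁.primeFactors.card = W.mordellWeilRank ∧
            (W.quadraticTwist (NumberField.discr K : ℚ)).mordellWeilRank = W.mordellWeilRank + 1)) ∧
        W.sha ⊓ AddSubgroup.torsionBy W.galH1 ((p ^ 1 : ℕ) : ℤ) = ⊥ ∧
        Nat.card ↥(selmerGroup W ((p ^ 1 : ℕ) : ℤ)) = p ^ W.mordellWeilRank := by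
  obtain ⟨p, hp, h5, hgood, hord, htower, K, iF, iN, hK, hD3, hD4, iNZ, hH, Dt, β, ι, n₁, d, hn₁, hk₁,
    hne, hrank⟩ := hS W hcm
  haveI := hp
  haveI := iNZ
  have hp2 : p ≠ 2 := by omega
  obtain ⟨c, hc, hcc⟩ := exists_conj_of_isImaginaryQuadratic K hK
  rcases hrank with hrank | ⟨hrank, hrank'⟩
  · obtain ⟨hsha, hr, hr', -, hbot, hSel⟩ :=
      shaCorank_eq_zero_of_kolyvaginClass_ne_zero_of_rank_le_of_datum_gross1991E0 h372 hE0 hcm hK hD3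
        hD4 hH p hp2 htower c hc hcc hn₁ hk₁ d hne hrank
    refine ⟨p, hp, h5, hgood, hord, hsha, K, iF, iN, n₁, hK, Or.inl ⟨hr.symm, by omega⟩, hbot, ?_⟩
    rw [hSel, hr]
  · obtain ⟨hsha, hr, -, hr', -, hbot, hSel, -⟩ :=
      shaCorank_eq_zero_of_kolyvaginClass_ne_zero_of_twist_rank_of_datum_gross1991E0 h372 hE0 hcm hK
        hD3 hD4 hH p hp2 htower c hc hcc hn₁ hk₁ d hne hrank hrank'
    refine ⟨p, hp, h5, hgood, hord, hsha, K, iF, iN, n₁, hK, Or.inr ⟨hr.symm, by omega⟩, hbot, ?_⟩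
    rw [hSel, hr]

/-- **Signed datum + (γ) + F1 + the CM residual ⟹ X1 for every elliptic curve over `ℚ`**: every
globally minimal elliptic `E/ℚ` has a prime `p ≥ 5` of good ordinary reduction with
`corank_{ℤ_p} Ш(E/ℚ)[p^∞] = 0` — LITERALLY `KatoTransfer`'s crux `ShaCorankZeroAtOnePrime`
(stmt-BirchSwinnertonDyer-18411). CONDITIONAL on `hS`, (γ), F1, `hCM`; BSD is not proved by it.
[cite: Kolyvagin1991MathAnn, Thm. 2.3] [cite: GrossLMS1991, Prop. 3.7 (2)] [cite: GrossZagier1986, III (3.1)] -/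
theorem shaCorankZeroAtOnePrime_of_kolyvaginDepthSupplySignedDatum_print
    (hS : KolyvaginDepthSupplySignedDatum) (h372 : GrossLMS1991.prop37_2_frobeniusCongruence)
    (hE0 : Gross1991_heegnerPoint_sub_ratTorsion_mem_E0) (hCM : ShaCorankZeroAtOnePrimeOfCM) :
    Summit.BirchSwinnertonDyer.BirchSwinnertonDyer.Theses.KatoTransfer.ShaCorankZeroAtOnePrime := by
  intro W _ _
  by_cases hcm : W.HasCM
  · exact hCM W hcm
  · obtain ⟨p, hp, h5, hgood, hord, hsha, -⟩ :=
      shaCorank_eq_zero_nonCM_of_kolyvaginDepthSupplySignedDatum_print hS h372 hE0 W hcm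
    exact ⟨p, hp, h5, hgood, hord, hsha⟩

/-- **The route from the signed datum form on print-standard inputs: signed datum + (γ) + F1 + X1_CM +
X2 + X3 + Kato ⟹ BSD-rank.** Hypotheses: `KolyvaginDepthSupplySignedDatum`, (γ), F1, and the route's
items `ShaCorankZeroAtOnePrimeOfCM`, `AnalyticRankLeSelmerCorank`, `PadicOrderLeAnalyticRankAtOnePrime`,
`KatoRankBound` VERBATIM; conclusion `_root_.BirchSwinnertonDyer`. The kernel X1 =
`shaCorankZeroAtOnePrime_of_kolyvaginDepthSupplySignedDatum_print` is handed to `KatoTransfer`'s certified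
deciding theorem `KatoTransfer.closes` (the items X2, X3, Kato of this route are KatoTransfer's verbatim,
so the hypotheses are definitionally those). NEITHER `KolyvaginStructure` (XL) NOR any McCallum leaf is
used. Every hypothesis is OPEN or a named published fact; NOTHING is discharged and BSD is NOT proved by
this. [cite: Kolyvagin1991MathAnn, Thm. 2.3] [cite: Kato2004Asterisque, Thm. 17.4]
[cite: GrossLMS1991, Prop. 3.7 (2)] [cite: GrossZagier1986, III (3.1)] -/
theorem bsd_of_kolyvaginDepthSupplySignedDatum_print (hS : KolyvaginDepthSupplySignedDatum)
    (h372 : GrossLMS1991.prop37_2_frobeniusCongruence)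
    (hE0 : Gross1991_heegnerPoint_sub_ratTorsion_mem_E0) (hCM : ShaCorankZeroAtOnePrimeOfCM)
    (hX2 : AnalyticRankLeSelmerCorank) (hX3 : PadicOrderLeAnalyticRankAtOnePrime)
    (hK : KatoRankBound) : _root_.BirchSwinnertonDyer :=
  Summit.BirchSwinnertonDyer.BirchSwinnertonDyer.Theses.KatoTransfer.closes
    (shaCorankZeroAtOnePrime_of_kolyvaginDepthSupplySignedDatum_print hS h372 hE0 hCM) hX2 hX3 hK

end Summit.BirchSwinnertonDyer.BirchSwinnertonDyer.Theorems.KolyvaginDepthDoor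

end
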